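import Summits.ValiantsHypothesis.ValiantsHypothesis.Theorems.KPlusLogSqLawWeakLiftingTowerGraftTwoSidedLoewner
import Summits.ValiantsHypothesis.ValiantsHypothesis.Theorems.KPlusLogSqLawWeakLiftingTowerGraftTwoSidedClusteredUppers
import Summits.ValiantsHypothesis.ValiantsHypothesis.Theorems.KPlusLogSqLawWeakLiftingTowerGraftTwoSidedThreeLettersLaw

/-!
# Tower graft line — CLUSTERED WORDS OF ANY LENGTH: the unconditional clustered-upper law and its `2m` census law

Crux `stmt-ValiantsHypothesis-19561` (`WeakLifting`), line (B) `tower_graft`, two-sided word instrument; seat val-sym-lift-p3 g21,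
`--supports 19561`, NO stub claimed.  Part F (`…TwoSidedClusteredUppers`, g20) proved: for the word `P₀ + τ^e J + Σₗ τ^{dₗ} Pₗ`
(`P₀, Pₗ ⪰ 0`, `J` ANY symmetric) the ENTERING-type kernel pairs number at most `rank P₀` PROVIDED every upper letter carries a
positive semidefinite Loewner certificate — typed there only for the four-letter instance `(d₀, d₀+2g, d₀+3g, d₀+4g)` (part G its census
law).  With the Loewner certificate for every real exponent (`…TwoSidedLoewner`, `Loewner.exists_certificate_clustered`) the
hypothesis is DISCHARGED on every clustered support `e < dₗ ≤ 2e` (`card_negType_le_rank_clustered_all`), and the census law follows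
for CLUSTERED WORDS OF ANY LENGTH (`card_posRoots_le_two_mul_clustered`): `F(X) = X^{d₀} P₀ + X^{d₀+e} J + Σₗ X^{d₀+δₗ} Pₗ` with
`P₀ ≻ 0`, `J` arbitrary symmetric, ANY NUMBER of PSD letters at `e < δₗ ≤ 2e` among which a positive definite top letter; simple
crossings ⇒ `Z₊ ≤ 2m` with multiplicity (entering roots `≤ rank P₀ = m`, `N⁺ = N⁻` by `Inertia.global_index_formula`).  The exponent
vector is `Matrix.vecCons d₀ (Matrix.vecCons (d₀ + e) (fun l => d₀ + δ l)) : Fin (L + 2) → ℕ`, the letters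
`Matrix.vecCons P₀ (Matrix.vecCons J P)`; type dictionary `t·P_u′(t) = t^{d₀}(Σₗ (δₗ − e) t^{δₗ}⟨u,Pₗu⟩ − e⟨u,P₀u⟩)`
(`rayleigh_deriv_eq_clustered`).  On TOWERS the same sign class reaches `3m` at `m = 2` (`TowerEscape.not_two_mul_law_tower`): the
clustering hypothesis is load-bearing.  HONEST FRAMING: a structural law for clustered supports of any length; nothing on the tower
column, S4…S5, `TowerB`, `WeakLifting` in its window, Conjecture B, 18050 or `VP ≠ VNP`.  Def-free.

[folklore] Loewner certificates + the inertia kit's global index formula.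
-/

set_option linter.dupNamespace false
set_option autoImplicit false

namespace Summit.ValiantsHypothesis.ValiantsHypothesis.Theorems.KPlusLogSqLaw.TowerGraft

open Matrix
open scoped BigOperators

namespace TwoSidedThree

/-! ## §1 The clustered-upper law with its certificates DISCHARGED (every clustered support) -/

section ClusteredAll

variable {m : ℕ} {I : Type} [Fintype I] [DecidableEq I] {L : ℕ}
variable (P₀ J : Matrix (Fin m) (Fin m) ℝ) (P : Fin L → Matrix (Fin m) (Fin m) ℝ) (e : ℕ) (d : Fin L → ℕ)
  (τ : I → ℝ) (u : I → Fin m → ℝ)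

/-- **THE CLUSTERED-UPPER LAW, UNCONDITIONAL (any number of PSD upper letters, every clustered support).**  Word
`P₀ + τ^e J + Σₗ τ^{dₗ} Pₗ` with `P₀ ⪰ 0`, `Pₗ ⪰ 0`, `J` ANY symmetric and EVERY UPPER GAP AT MOST THE LOWER GAP (`e < dₗ ≤ 2e`):
kernel pairs of NEGATIVE (entering) type at distinct positive scales number at most `rank P₀` — part F's
`card_negType_le_rank_clustered` with its per-letter Loewner certificates supplied by `Loewner.exists_certificate_clustered`
(exponents `(dₗ − e)/e ∈ (0,1]`). [folklore] -/
theorem card_negType_le_rank_clustered_all (hP₀ : P₀.PosSemidef) (hJ : J.IsSymm) (hP : ∀ l, (P l).PosSemidef)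
    (hτ : ∀ i, 0 < τ i) (hinj : Function.Injective τ) (he : 0 < e) (hd : ∀ l, e < d l ∧ d l ≤ 2 * e)
    (hker : ∀ i, (P₀ + τ i ^ e • J + ∑ l, τ i ^ d l • P l) *ᵥ u i = 0)
    (htype : ∀ i, ∑ l, ((d l - e : ℕ) : ℝ) * τ i ^ d l * (u i ⬝ᵥ (P l *ᵥ u i)) < e * (u i ⬝ᵥ (P₀ *ᵥ u i))) :
    Fintype.card I ≤ P₀.rank := by
  classical
  have hN := fun l => Loewner.exists_certificate_clustered (I := I) he (hd l).1 (hd l).2 τ hτ hinj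
  choose N hNpsd hNdiag hNoff using hN
  exact card_negType_le_rank_clustered P₀ J P e d τ u hP₀ hJ hP hτ hinj he hker htype N hNpsd hNdiag hNoff

end ClusteredAll

/-! ## §2 Census currency: clustered words of ANY LENGTH and their `2m` law -/

section ClusteredCensus

open Polynomial
open Summit.ValiantsHypothesis.ValiantsHypothesis.Theorems.LacunarySymmetroidMatrixDescartes

variable {m L : ℕ}

/-- the clustered word `X^{d₀} P₀ + X^{d₀+e} J + Σₗ X^{d₀+δₗ} Pₗ` evaluated at `t` is `t^{d₀}·(P₀ + t^e J + Σₗ t^{δₗ} Pₗ)`. [folklore] -/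
theorem pencil_clustered_eval (P₀ J : Matrix (Fin m) (Fin m) ℝ) (P : Fin L → Matrix (Fin m) (Fin m) ℝ) (d₀ e : ℕ)
    (δ : Fin L → ℕ) (t : ℝ) :
    (∑ k : Fin (L + 2), t ^ (Matrix.vecCons d₀ (Matrix.vecCons (d₀ + e) fun l => d₀ + δ l) k) •
        (Matrix.vecCons P₀ (Matrix.vecCons J P) k))
      = t ^ d₀ • (P₀ + t ^ e • J + ∑ l, t ^ δ l • P l) := by
  rw [Fin.sum_univ_succ, Fin.sum_univ_succ]
  simp only [Matrix.cons_val_zero, Matrix.cons_val_succ]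
  have hsum : (∑ l : Fin L, t ^ d₀ • (t ^ δ l • P l)) = ∑ l : Fin L, t ^ (d₀ + δ l) • P l :=
    Finset.sum_congr rfl fun l _ => by rw [smul_smul, ← pow_add]
  rw [smul_add, smul_add, Finset.smul_sum, smul_smul, ← pow_add, hsum, add_assoc]

/-- kernel vectors of the evaluated clustered word are kernel vectors of the reduced word (`t > 0`). [folklore] -/
theorem reduced_kernel_clustered (P₀ J : Matrix (Fin m) (Fin m) ℝ) (P : Fin L → Matrix (Fin m) (Fin m) ℝ) (d₀ e : ℕ)
    (δ : Fin L → ℕ) {t : ℝ} (ht : 0 < t) (u : Fin m → ℝ)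
    (hu : (∑ k : Fin (L + 2), t ^ (Matrix.vecCons d₀ (Matrix.vecCons (d₀ + e) fun l => d₀ + δ l) k) •
        (Matrix.vecCons P₀ (Matrix.vecCons J P) k)) *ᵥ u = 0) :
    (P₀ + t ^ e • J + ∑ l, t ^ δ l • P l) *ᵥ u = 0 := by
  rw [pencil_clustered_eval, Matrix.smul_mulVec] at hu
  exact (smul_eq_zero.mp hu).resolve_left (pow_ne_zero _ (ne_of_gt ht))

/-- **type dictionary for clustered words**: at a kernel vector `u` of the word at `t > 0`,
`t·P_u′(t) = t^{d₀}·(Σₗ (δₗ − e) t^{δₗ}⟨u,Pₗu⟩ − e⟨u,P₀u⟩)` (for `e ≤ δₗ`). [folklore] -/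
theorem rayleigh_deriv_eq_clustered (P₀ J : Matrix (Fin m) (Fin m) ℝ) (P : Fin L → Matrix (Fin m) (Fin m) ℝ) (d₀ e : ℕ)
    (δ : Fin L → ℕ) (hδ : ∀ l, e ≤ δ l) {t : ℝ} (ht : 0 < t) (u : Fin m → ℝ)
    (hu : (∑ k : Fin (L + 2), t ^ (Matrix.vecCons d₀ (Matrix.vecCons (d₀ + e) fun l => d₀ + δ l) k) •
        (Matrix.vecCons P₀ (Matrix.vecCons J P) k)) *ᵥ u = 0) :
    t * (derivative (∑ k : Fin (L + 2), C (u ⬝ᵥ ((Matrix.vecCons P₀ (Matrix.vecCons J P) k) *ᵥ u)) *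
        (X : ℝ[X]) ^ (Matrix.vecCons d₀ (Matrix.vecCons (d₀ + e) fun l => d₀ + δ l) k))).eval t
      = t ^ d₀ * (∑ l, ((δ l - e : ℕ) : ℝ) * t ^ δ l * (u ⬝ᵥ (P l *ᵥ u)) - e * (u ⬝ᵥ (P₀ *ᵥ u))) := by
  have hred := reduced_kernel_clustered P₀ J P d₀ e δ ht u hu
  -- the Rayleigh polynomial vanishes at `t`
  have hray : u ⬝ᵥ (P₀ *ᵥ u) + t ^ e * (u ⬝ᵥ (J *ᵥ u)) + ∑ l, t ^ δ l * (u ⬝ᵥ (P l *ᵥ u)) = 0 := by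
    have h := congrArg (fun w => u ⬝ᵥ w) hred
    simp only [dotProduct_zero, Matrix.add_mulVec, Matrix.smul_mulVec, Matrix.sum_mulVec, dotProduct_add,
      dotProduct_smul, dotProduct_sum, smul_eq_mul] at h
    linarith
  rw [← Multiplicity.form_derivative_eq_eval]
  -- `t · Σ_k dv_k t^{dv_k − 1} ⟨u, S_k u⟩ = Σ_k dv_k t^{dv_k} ⟨u, S_k u⟩`
  rw [Matrix.sum_mulVec, dotProduct_sum, Finset.mul_sum]
  have hstep : ∀ k : Fin (L + 2),
      t * (u ⬝ᵥ ((((Matrix.vecCons d₀ (Matrix.vecCons (d₀ + e) fun l => d₀ + δ l) k : ℕ) : ℝ) *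
          t ^ ((Matrix.vecCons d₀ (Matrix.vecCons (d₀ + e) fun l => d₀ + δ l) k) - 1)) •
          Matrix.vecCons P₀ (Matrix.vecCons J P) k) *ᵥ u)
        = (((Matrix.vecCons d₀ (Matrix.vecCons (d₀ + e) fun l => d₀ + δ l) k : ℕ) : ℝ) *
          t ^ (Matrix.vecCons d₀ (Matrix.vecCons (d₀ + e) fun l => d₀ + δ l) k)) *
          (u ⬝ᵥ (Matrix.vecCons P₀ (Matrix.vecCons J P) k *ᵥ u)) := by
    intro k
    rw [Matrix.smul_mulVec, dotProduct_smul, smul_eq_mul, ← mul_assoc,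
      SecularRolle.mul_natCast_mul_pow_pred t _]
  rw [Finset.sum_congr rfl fun k _ => hstep k]
  rw [Fin.sum_univ_succ, Fin.sum_univ_succ]
  simp only [Matrix.cons_val_zero, Matrix.cons_val_succ]
  push_cast
  -- the two sums over the upper letters, in the atoms `S₁ = Σ t^{δ}b`, `S₂ = Σ δ t^{δ} b`
  have hS3 : ∑ l : Fin L, ((d₀ : ℝ) + (δ l : ℝ)) * t ^ (d₀ + δ l) * (u ⬝ᵥ (P l *ᵥ u))
      = t ^ d₀ * ((d₀ : ℝ) * ∑ l, t ^ δ l * (u ⬝ᵥ (P l *ᵥ u)) + ∑ l, (δ l : ℝ) * t ^ δ l * (u ⬝ᵥ (P l *ᵥ u))) := by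
    rw [Finset.mul_sum, ← Finset.sum_add_distrib, Finset.mul_sum]
    refine Finset.sum_congr rfl fun l _ => ?_
    rw [pow_add]; ring
  have hS4 : ∑ l : Fin L, ((δ l - e : ℕ) : ℝ) * t ^ δ l * (u ⬝ᵥ (P l *ᵥ u))
      = ∑ l, (δ l : ℝ) * t ^ δ l * (u ⬝ᵥ (P l *ᵥ u)) - (e : ℝ) * ∑ l, t ^ δ l * (u ⬝ᵥ (P l *ᵥ u)) := by
    rw [Finset.mul_sum, ← Finset.sum_sub_distrib]
    refine Finset.sum_congr rfl fun l _ => ?_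
    rw [Nat.cast_sub (hδ l)]; ring
  rw [hS3, hS4, pow_add]
  have hJ : t ^ e * (u ⬝ᵥ (J *ᵥ u)) = -(u ⬝ᵥ (P₀ *ᵥ u)) - ∑ l, t ^ δ l * (u ⬝ᵥ (P l *ᵥ u)) := by linarith
  have h4 : ((d₀ : ℝ) + (e : ℝ)) * (t ^ d₀ * t ^ e) * (u ⬝ᵥ (J *ᵥ u))
      = ((d₀ : ℝ) + e) * t ^ d₀ * (t ^ e * (u ⬝ᵥ (J *ᵥ u))) := by ring
  rw [h4, hJ]
  ring

/-- **entering-type roots of a clustered word number at most `rank P₀`** (census currency; `P₀, Pₗ ⪰ 0`, `J` symmetric,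
`e < δₗ ≤ 2e`). [folklore] -/
theorem card_negType_roots_le_clustered (P₀ J : Matrix (Fin m) (Fin m) ℝ) (P : Fin L → Matrix (Fin m) (Fin m) ℝ)
    (hP₀ : P₀.PosSemidef) (hJ : J.IsSymm) (hP : ∀ l, (P l).PosSemidef) (d₀ e : ℕ) (δ : Fin L → ℕ) (he : 0 < e)
    (hδ : ∀ l, e < δ l ∧ δ l ≤ 2 * e) (T : Finset ℝ) (hT : ∀ t ∈ T, 0 < t)
    (hroot : ∀ t ∈ T, ∃ u : Fin m → ℝ,
      (∑ k : Fin (L + 2), t ^ (Matrix.vecCons d₀ (Matrix.vecCons (d₀ + e) fun l => d₀ + δ l) k) •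
        (Matrix.vecCons P₀ (Matrix.vecCons J P) k)) *ᵥ u = 0 ∧
      (derivative (∑ k : Fin (L + 2), C (u ⬝ᵥ ((Matrix.vecCons P₀ (Matrix.vecCons J P) k) *ᵥ u)) *
        (X : ℝ[X]) ^ (Matrix.vecCons d₀ (Matrix.vecCons (d₀ + e) fun l => d₀ + δ l) k))).eval t < 0) :
    T.card ≤ P₀.rank := by
  classical
  choose! u hu using hroot
  have h := card_negType_le_rank_clustered_all (I := T) P₀ J P e δ (fun t => (t : ℝ)) (fun t => u t) hP₀ hJ hP
    (fun t => hT t t.2) Subtype.coe_injective he hδ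
    (fun t => reduced_kernel_clustered P₀ J P d₀ e δ (hT t t.2) _ (hu t t.2).1) ?_
  · simpa using h
  · intro t
    have ht := hT t t.2
    have hneg := (hu t t.2).2
    have heq := rayleigh_deriv_eq_clustered P₀ J P d₀ e δ (fun l => (hδ l).1.le) ht _ (hu t t.2).1
    have h1 : (t : ℝ) * (derivative (∑ k : Fin (L + 2), C (u t ⬝ᵥ ((Matrix.vecCons P₀ (Matrix.vecCons J P) k) *ᵥ u t)) *
        (X : ℝ[X]) ^ (Matrix.vecCons d₀ (Matrix.vecCons (d₀ + e) fun l => d₀ + δ l) k))).eval (t : ℝ) < 0 :=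
      mul_neg_of_pos_of_neg ht hneg
    rw [heq] at h1
    have h2 : 0 < (t : ℝ) ^ d₀ := pow_pos ht _
    have h3 : (∑ l, ((δ l - e : ℕ) : ℝ) * (t : ℝ) ^ δ l * (u t ⬝ᵥ (P l *ᵥ u t))) - e * (u t ⬝ᵥ (P₀ *ᵥ u t)) < 0 := by
      by_contra hcon
      push Not at hcon
      have := mul_nonneg h2.le hcon
      linarith
    linarith

/-- **THE `2m` LAW FOR CLUSTERED WORDS OF ANY LENGTH (simple crossings).**  `P₀ ≻ 0` at the bottom exponent `d₀`, `J` ANY symmetric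
at `d₀ + e` (`e ≥ 1`), ANY NUMBER `L` of positive semidefinite letters `Pₗ` at exponents `d₀ + δₗ` with `e < δₗ ≤ 2e` (every upper
gap `δₗ − e` at most the lower gap `e`), among them a positive DEFINITE top letter `P_{l₁}` (`δₗ < δ_{l₁}` for `l ≠ l₁`).  If every positive
root of `det F` is a simple crossing, then the positive roots of `det F` counted with multiplicity number at most `2m`: the entering-type
roots are `≤ rank P₀ = m` (`card_negType_roots_le_clustered`) and `N⁺ = N⁻` by `Inertia.global_index_formula` (`ν(P₀) = ν(P_{l₁}) = 0`).
Parts G (`(d₀, d₀+2g, d₀+3g, d₀+4g)`) and B/E-type three-letter words with `f ≤ e`... are instances; on TOWERS the law fails already at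
`m = 2` (`TowerEscape.not_two_mul_law_tower`), so the clustering hypothesis is load-bearing. [folklore] -/
theorem card_posRoots_le_two_mul_clustered (P₀ J : Matrix (Fin m) (Fin m) ℝ) (P : Fin L → Matrix (Fin m) (Fin m) ℝ)
    (hP₀ : P₀.PosDef) (hJ : J.IsSymm) (hP : ∀ l, (P l).PosSemidef) (l₁ : Fin L) (htop : (P l₁).PosDef)
    (d₀ e : ℕ) (δ : Fin L → ℕ) (he : 0 < e) (hδ : ∀ l, e < δ l ∧ δ l ≤ 2 * e) (hδtop : ∀ l, l ≠ l₁ → δ l < δ l₁)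
    (hcorank : ∀ t : ℝ, 0 < t →
      (∑ k : Fin (L + 2), t ^ (Matrix.vecCons d₀ (Matrix.vecCons (d₀ + e) fun l => d₀ + δ l) k) •
        (Matrix.vecCons P₀ (Matrix.vecCons J P) k)).det = 0 →
      (∑ k : Fin (L + 2), t ^ (Matrix.vecCons d₀ (Matrix.vecCons (d₀ + e) fun l => d₀ + δ l) k) •
        (Matrix.vecCons P₀ (Matrix.vecCons J P) k)).rank + 1 = m)
    (htype : ∀ t : ℝ, 0 < t →
      (∑ k : Fin (L + 2), t ^ (Matrix.vecCons d₀ (Matrix.vecCons (d₀ + e) fun l => d₀ + δ l) k) •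
        (Matrix.vecCons P₀ (Matrix.vecCons J P) k)).det = 0 →
      (∀ u : Fin m → ℝ, (∑ k : Fin (L + 2), t ^ (Matrix.vecCons d₀ (Matrix.vecCons (d₀ + e) fun l => d₀ + δ l) k) •
          (Matrix.vecCons P₀ (Matrix.vecCons J P) k)) *ᵥ u = 0 → u ≠ 0 →
        (derivative (∑ k : Fin (L + 2), C (u ⬝ᵥ ((Matrix.vecCons P₀ (Matrix.vecCons J P) k) *ᵥ u)) *
          (X : ℝ[X]) ^ (Matrix.vecCons d₀ (Matrix.vecCons (d₀ + e) fun l => d₀ + δ l) k))).eval t < 0) ∨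
      (∀ u : Fin m → ℝ, (∑ k : Fin (L + 2), t ^ (Matrix.vecCons d₀ (Matrix.vecCons (d₀ + e) fun l => d₀ + δ l) k) •
          (Matrix.vecCons P₀ (Matrix.vecCons J P) k)) *ᵥ u = 0 → u ≠ 0 →
        0 < (derivative (∑ k : Fin (L + 2), C (u ⬝ᵥ ((Matrix.vecCons P₀ (Matrix.vecCons J P) k) *ᵥ u)) *
          (X : ℝ[X]) ^ (Matrix.vecCons d₀ (Matrix.vecCons (d₀ + e) fun l => d₀ + δ l) k))).eval t)) :
    Multiset.card ((Matrix.det (∑ k : Fin (L + 2),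
        ((X : ℝ[X]) ^ (Matrix.vecCons d₀ (Matrix.vecCons (d₀ + e) fun l => d₀ + δ l) k)) •
          (Matrix.vecCons P₀ (Matrix.vecCons J P) k).map C)).roots.filter (fun t => 0 < t)) ≤ 2 * m := by
  classical
  set dv : Fin (L + 2) → ℕ := Matrix.vecCons d₀ (Matrix.vecCons (d₀ + e) fun l => d₀ + δ l) with hdv
  set Sv : Fin (L + 2) → Matrix (Fin m) (Fin m) ℝ := Matrix.vecCons P₀ (Matrix.vecCons J P) with hSv
  have hP₀s : P₀.IsSymm := by
    have h1 := hP₀.1; unfold Matrix.IsHermitian at h1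
    rwa [Matrix.conjTranspose_eq_transpose_of_trivial] at h1
  have hPs : ∀ l, (P l).IsSymm := by
    intro l; have h1 := (hP l).1; unfold Matrix.IsHermitian at h1
    rwa [Matrix.conjTranspose_eq_transpose_of_trivial] at h1
  have hS : ∀ k, (Sv k).IsSymm := by
    intro k
    refine Fin.cases ?_ (fun k => ?_) k
    · simpa [hSv] using hP₀s
    · refine Fin.cases ?_ (fun l => ?_) k
      · simpa [hSv] using hJ
      · simpa [hSv] using hPs l
  -- bottom index `0`, top index `l₁.succ.succ`
  have hdv0 : dv 0 = d₀ := by simp [hdv]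
  have hdv1 : dv 1 = d₀ + e := by simp [hdv]
  have hdvl : ∀ l : Fin L, dv l.succ.succ = d₀ + δ l := by intro l; simp [hdv]
  have hmin : ∀ k : Fin (L + 2), k ≠ 0 → dv 0 < dv k := by
    intro k hk
    rw [hdv0]
    revert hk
    refine Fin.cases ?_ (fun k => ?_) k
    · intro h; exact absurd rfl h
    · intro _
      refine Fin.cases ?_ (fun l => ?_) k
      · show d₀ < dv 1; rw [hdv1]; omega
      · rw [hdvl]; have := (hδ l).1; omega
  have hmax : ∀ k : Fin (L + 2), k ≠ l₁.succ.succ → dv k < dv l₁.succ.succ := by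
    intro k hk
    rw [hdvl l₁]
    revert hk
    refine Fin.cases ?_ (fun k => ?_) k
    · intro _; rw [hdv0]; have := (hδ l₁).1; omega
    · refine Fin.cases ?_ (fun l => ?_) k
      · intro _; show dv 1 < d₀ + δ l₁; rw [hdv1]; have := (hδ l₁).1; omega
      · intro hne
        rw [hdvl]
        have hl : l ≠ l₁ := fun h => hne (by rw [h])
        have := hδtop l hl
        omega
  have h0 : (Sv 0).det ≠ 0 := by
    show (Matrix.vecCons P₀ (Matrix.vecCons J P) 0).det ≠ 0
    simp only [Matrix.cons_val_zero]; exact hP₀.det_pos.ne'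
  have h2 : (Sv l₁.succ.succ).det ≠ 0 := by
    show (Matrix.vecCons P₀ (Matrix.vecCons J P) l₁.succ.succ).det ≠ 0
    simp only [Matrix.cons_val_succ]; exact htop.det_pos.ne'
  let negType : ℝ → Prop := fun t => ∀ u : Fin m → ℝ, (∑ k, t ^ dv k • Sv k) *ᵥ u = 0 → u ≠ 0 →
    (derivative (∑ k, C (u ⬝ᵥ (Sv k *ᵥ u)) * (X : ℝ[X]) ^ dv k)).eval t < 0
  obtain ⟨hidx, -, hsum⟩ := Inertia.global_index_formula dv Sv hS 0 l₁.succ.succ hmin hmax h0 h2 htype negType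
    (fun t _ _ => Iff.rfl)
  have hν0 : Fintype.card {j // (Inertia.isHermitian_of_isSymm (hS 0)).eigenvalues j < 0} = 0 := by
    rw [Fintype.card_eq_zero_iff]
    refine ⟨fun ⟨j, hj⟩ => ?_⟩
    have hP₀' : (Sv 0).PosDef := by
      show (Matrix.vecCons P₀ (Matrix.vecCons J P) 0).PosDef
      simp only [Matrix.cons_val_zero]; exact hP₀
    have hp : 0 < (Inertia.isHermitian_of_isSymm (hS 0)).eigenvalues j := hP₀'.eigenvalues_pos j
    linarith
  have hν2 : Fintype.card {j // (Inertia.isHermitian_of_isSymm (hS l₁.succ.succ)).eigenvalues j < 0} = 0 := by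
    rw [Fintype.card_eq_zero_iff]
    refine ⟨fun ⟨j, hj⟩ => ?_⟩
    have htop' : (Sv l₁.succ.succ).PosDef := by
      show (Matrix.vecCons P₀ (Matrix.vecCons J P) l₁.succ.succ).PosDef
      simp only [Matrix.cons_val_succ]; exact htop
    have hp : 0 < (Inertia.isHermitian_of_isSymm (hS l₁.succ.succ)).eigenvalues j := htop'.eigenvalues_pos j
    linarith
  rw [hν0, hν2, zero_add, zero_add] at hidx
  set Pd := Matrix.det (∑ k, ((X : ℝ[X]) ^ dv k) • (Sv k).map C) with hPd
  have hdef : ∀ t : ℝ, 0 < t → (∑ k, t ^ dv k • Sv k).det = 0 → ∀ v : Fin m → ℝ, (∑ k, t ^ dv k • Sv k) *ᵥ v = 0 →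
      v ≠ 0 → (derivative (∑ k, C (v ⬝ᵥ (Sv k *ᵥ v)) * (X : ℝ[X]) ^ dv k)).eval t ≠ 0 := by
    intro t ht hdet v hv hv0
    rcases htype t ht hdet with h | h
    · exact ne_of_lt (h v hv hv0)
    · exact ne_of_gt (h v hv hv0)
  -- the entering-type positive roots form a multiset without repetition
  set q : ℝ → Prop := fun t => 0 < t ∧ negType t with hq
  have hnodup : (Pd.roots.filter q).Nodup := by
    rw [Multiset.nodup_iff_count_le_one]
    intro a
    by_cases hqa : q a
    · rw [Multiset.count_filter_of_pos hqa, count_roots]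
      by_cases hr : (∑ k, a ^ dv k • Sv k).det = 0
      · have h1 := Multiplicity.rootMultiplicity_det_pencil_eq_one dv Sv hS a
          (by rw [Fintype.card_fin]; exact hcorank a hqa.1 hr) (hdef a hqa.1 hr)
        rw [← hPd] at h1
        omega
      · have hnr : ¬ Pd.IsRoot a := by
          intro hroot
          apply hr
          have h1 : Pd.eval a = 0 := hroot
          rwa [hPd, DefiniteMoments.eval_det_pencil] at h1
        rw [Polynomial.rootMultiplicity_eq_zero hnr]
        exact zero_le_one
    · rw [Multiset.count_filter_of_neg hqa]
      exact zero_le_one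
  set T := (Pd.roots.filter q).toFinset with hTdef
  have hTcard : T.card = Multiset.card (Pd.roots.filter q) := Multiset.toFinset_card_of_nodup hnodup
  have hTpos : ∀ t ∈ T, 0 < t := fun t ht => (Multiset.mem_filter.mp (Multiset.mem_toFinset.mp ht)).2.1
  have hTroot : ∀ t ∈ T, ∃ u : Fin m → ℝ, (∑ k, t ^ (dv k) • (Sv k)) *ᵥ u = 0 ∧
      (derivative (∑ k, C (u ⬝ᵥ ((Sv k) *ᵥ u)) * (X : ℝ[X]) ^ (dv k))).eval t < 0 := by
    intro t ht
    obtain ⟨hmem, htq⟩ := Multiset.mem_filter.mp (Multiset.mem_toFinset.mp ht)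
    obtain ⟨hP0, hroot⟩ := (Polynomial.mem_roots').mp hmem
    have hdet : (∑ k, t ^ dv k • Sv k).det = 0 := by
      have h1 : Pd.eval t = 0 := hroot
      rwa [hPd, DefiniteMoments.eval_det_pencil] at h1
    obtain ⟨u, hu0, hu⟩ := Matrix.exists_mulVec_eq_zero_iff.mpr hdet
    exact ⟨u, hu, htq.2 u hu hu0⟩
  have hTle : T.card ≤ P₀.rank :=
    card_negType_roots_le_clustered P₀ J P hP₀.posSemidef hJ hP d₀ e δ he hδ T hTpos hTroot
  have hP₀m : P₀.rank ≤ m := (Matrix.rank_le_width P₀).trans le_rfl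
  rw [← hsum]
  have hN : Multiset.card (Pd.roots.filter q) ≤ m := by rw [← hTcard]; exact hTle.trans hP₀m
  have hidx' : Multiset.card (Pd.roots.filter fun t => 0 < t ∧ ¬ negType t) = Multiset.card (Pd.roots.filter q) := hidx
  rw [hidx']
  omega

end ClusteredCensus

end TwoSidedThree

end Summit.ValiantsHypothesis.ValiantsHypothesis.Theorems.KPlusLogSqLaw.TowerGraft
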